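import Summits.Langlands.Langlands.Theorems.SqrtFiveQuarticCoversCertB3H8
import Summits.Langlands.Langlands.Theorems.SqrtFiveQuarticCoversCertH12B7
import Summits.Langlands.Langlands.Theorems.SqrtFiveQuarticCoversCertB3E7
import Summits.Langlands.Langlands.Theorems.SqrtFiveQuarticCoversCertS3H12
import Summits.Langlands.Langlands.Theorems.SqrtFiveQuarticCoversSheets

/-!
# Route `Langlands/SqrtFiveQuarticCovers` — THE RECORD: the crux `RefinedLocusModular` and the route's
# `Target` from EVERY NAMED INPUT of the five certificate children, written out in one statement
# (cell `pub/lg-quartmod`, rung F-L1; CONDITIONAL bookkeeping — closes nothing by itself)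

Label of record (director-frontier 2026-08-28T20:30:18Z): «`RefinedLocusModular` CLOSED IN TREE modulo
named printed theorems + named certified finite computations, each on two independent exact lineages;
a certified finite datum is not a modularity statement UNTIL the assembly theorem says which facts it
rests on».  This file is that assembly theorem: the hypotheses of `refinedLocusModular_of_namedInputs`
(resp. `target_of_namedInputs`) are EXACTLY the named inputs of the five typed certificate files — each
binder byte-identical to the child's — plus the printed theorems present as named Literature facts;
the proof is ONE application of the ledger glue `refinedLocusModularGlue_of_facts` (resp.
`target_of_sheets_of_facts`; asm-plan, `SqrtFiveQuarticCoversSheets.lean`) to the five child theorems.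
Nothing is assumed beyond what the children assume; nothing new is proved; the kernel checks the fit.

## The inputs (hypothesis · child, sheets, carrier · KIND · provenance; full texts, data and named
## sub-inputs in the module docstring of the child's file)

Children of the crux (route rev 7, split by carrier): `CertB3H8` (stmt-Langlands-23413),
`CertH12B7` (-23414), `CertS3H8` (-23415), `CertB3E7` (-23416), `CertS3H12` (-23417); glue -23418.

* `hE6` · `CertB3H8`, 4.2+4.6, `X(b3,H8) = X₀(75)^ε` g5 ↔ `C = X₀(75)/w₂₅` g3 · CERTIFIED FINITE
  COMPUTATION «CERT-E6: `b3 ∧ H8` framings over a totally real quartic `K ∋ √5` ⇒ `c₄ = 0` or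
  `Δ⁴·m_B(c₄³/Δ) = 0`» (datum: `X(b3,H8)(k)` = 8 cusps, exactly 9 quadratic points over `k`; `C(k) = 9`,
  exactly 67 quadratic points) · lineages ref-1 E6 genus-5 sieve (E6-PREP.md 8b99305451eee2f7) ∥ eng-1 +
  ref-1 coarse chain (README 8b20cbd00b243608; E6P-TABLE b7244e5a42961ffe, certs-v2 a87f9b0d1dfcc4d9 /
  certs-v3 7842104d862748ca, stage J j313785) · certnum `pub/certnum/RELEASES.md` l.124, l.128, l.130,
  l.135–l.139 (RQ-026 CLOSED), rank-0 rows l.123 · model identification NF-K1 (FLS 2015 §2.2, §5.2 p. 24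
  printed coarse model) is a named sub-input of the datum · file `SqrtFiveQuarticCoversCertB3H8.lean`
  (typ-1), theorem `certB3H8_of_facts`.
* `hB` · `CertB3H8` (orbit B) · CERTIFIED FINITE COMPUTATION «CERT-E11(B), witness form: `[K:ℚ] = 4`,
  `m_B(j(E)) = 0` ⇒ every framing of `E[7]` contains an element with `det ∈ {3,5,6}`, `tr ≠ 0`,
  non-square discriminant» (datum `a_𝔓 = −5` at `𝔓 ∣ 19` of `K₁`; paper transfer to all twists /
  conjugates spelled out in the child's docstring) · lineages eng-8 E11-TWIN (e11twin.gp 413ed5c8a0e015f6,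
  run.log 0ad8bb9f48e7bd30) ∥ eng-9 E11 modular-polynomial lineage (stdout-j313273-K1.log) · not
  certnum-released (one-line `ellap` replay) · same file, same theorem.
* `hK1Z` · `CertH12B7`, 4.1+4.3, `Z = X(H12,b7)` g9 · MODEL IDENTIFICATION NF-K1-Z (named, not proved:
  the tree has no modular-curve carrier) — PRINT `J₇` [Zywina 2015 Thm. 1.4 = Chen 1999 (53)], `X₀(7)`
  Hauptmodul [Cremona–Freitas 2022 §3.6, after Fricke], moduli interpretation [FLS 2015 §2.2; Chen 1999
  Thm. 3.2; Deligne–Rapoport IV-3]; CELL the sign conic `w² = (5+2√5)(8t²−12t+7)` (twist class pinned by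
  point counts at eight primes incl. `p = 59`; DERIVED count-free by eng-5 g2, DERIVATION-H12-CONIC.md
  b9b2c12f033f5452, ref-1 referee-read PASS, and by eng-1 g3 from one CM point) · file
  `SqrtFiveQuarticCoversCertH12B7.lean` (typ-2),
  theorem `certH12B7` (binder named `hK1` there).
* `hZ` · `CertH12B7` · CERTIFIED FINITE COMPUTATION «THEOREM Z: `Z(k)` = 8 cusps; the quadratic points of
  `Z` over `k` are two CM pairs (`u = ∓7`) and four `θ`-pairs (`2u² + (35 ± 5r)u + 98 = 0`, over a field
  of signature (2,1))» · lineages Z-B: eng-2 ε-Prym α-sieve (README-E7.md acceefaa15e0bd61, certnum-E7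
  packet b7bc02aba12c49bf) ∥ eng-3 twin (E7-TWIN.md 0f3708606b8d5e74), replays ref-1 α-replay + eng-9 g2
  CROSS-READ-E7 (5eecce5a56f6420c → 7dec24a935b664b3); Z-A: eng-2 P7 (j314151) ∥ eng-8 E7-P7-TWIN
  (README 1de216a3662ba415) · certnum RQ-029 open (l.150 P1 IDENT PASS; P2–P6 in production) · same file.
* `hM` · `CertS3H8`, 4.4+4.8, `X(s3,H8) = (X₀(225)/w₉)^ε` g9 over `X(s3,s5)` g4 · PRINTED THEOREM as a
  named Literature fact `Literature.NumberTheory.Automorphic.FLS2015.s3s5_jRelation_of_isTorsionGaloisRep`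
  (file `Literature/NumberTheory/Automorphic/FLSModularCurveSplitThreeSplitFive.lean`, p667160):
  FLS 2015 §2.2 + §5.3, the printed canonical model of `X(s3,s5)` in `ℙ³` and its `j`-map, completed at
  the zeros of the printed denominator (the completion values are exact evaluations of the printed map,
  declared so in the fact's docstring).
* `hE9` · `CertS3H8` · CERTIFIED FINITE COMPUTATION «CERT-E9′: at every point of the printed model of
  `X(s3,s5)` over a totally real quartic `K ∋ √5`, `JDen = 0` or `JNum = (a + b r)·JDen`» (datum:
  `X(s3,s5)(k)` = 6 cusps + 6 CM, `D₁(k) = ℤ/8`, `J(D₃)(k) = ℤ/40`, 15 exceptional classes; fine: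
  degree-≤2 points of `X(s3,H8)` over `k` = 8 cusps + 2 cuspidal pairs + 6 CM(−32768) + 2 CM(1728)) ·
  lineages eng-9 E9-COARSE (75c718e0b5108ddd, README c829be806a3a1821) ∥ eng-3 E9 (E9-RESULT.md
  00025806a59bf964 + REPRO.md) · certnum l.131 TORJ2, l.132 TORE, l.133 SQC, l.134 PT (RQ-026 (ii)),
  rank-0 rows l.123 · file `SqrtFiveQuarticCoversCertS3H8.lean` (typ-1), theorem `certS3H8_of_facts`.
* `hK1E10` · `CertB3E7`, 4.5, `X(b3,e7)` g9 over `X(e7) ≅ 49a4` · MODEL IDENTIFICATION NF-K1-E10 —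
  PRINT `y² = 7q(x)`, `j = N/D`, `X(e7)(ℚ)` [FLS 2015 Lemma 4.2, p. 28] + moduli interpretation; CELL
  the level-3 correspondence `Ψ₃` (eng-8 E10-REPORT (b1) ∥ eng-3 E10-TWIN row 4(c); certnum K4 check Z7)
  and the exclusion of `x₂ = ∞` over a quartic `K ∋ √5` · file `SqrtFiveQuarticCoversCertB3E7.lean`
  (typ-2), theorem `certB3E7` (binder named `hK1` there).
* `hE49` · `CertB3E7` · FINITE DATUM + named print «NF-E10-MW: `X(e7)(ℚ(√5)) = {(−1/3, ±14/9)}` and the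
  group law read on `x`» — rank 0 of `49a4` over `k` from the EXACT non-vanishing
  `L(49a,1)·L(49a⊗χ₅,1) ≠ 0` (certnum l.140 K1 LV0; eng-8 j313052 ∥ eng-3 modular symbols) + the
  printed theorem of Kolyvagin–Logachev (named, not in the tree) + torsion `ℤ/2` (l.140 K2 TORE).
* `hZmm`, `hZmi` · `CertB3E7` · CERTIFIED FINITE COMPUTATION «NF-E10-ZDS census: the closed points of
  degree ≤ 2 over `k` of `{Ψ₃ = 0} ∩ τ{Ψ₃ = 0}`, `τ ∈ {m×m, m×id}`» · lineages eng-8 E10-REPORT.md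
  27124f46183f2158 (packet 8c57475d200e1699) ∥ eng-3 E10-TWIN.md 74120e68cc47c051 ∥ METHOD-DISJOINT
  eng-1 g3 E10X (Hecke-correspondence map `X(b3,e7) → X₀(21) ≅ 21a1` computed exactly in `21a1(ℚ(X))`,
  no `Ψ₃`/`w₃`/sieve; E10X-REPORT.md 21347fd33ceba04b = E10 point-for-point) · certnum l.140–l.142,
  RQ-027 ALL FOUR KINDS CERTIFIED, CLOSED (K4 ZDS `zds-e10-all.json` 7467a9eb771d1498) · same file.
* `hNF` · `CertS3H12`, 4.7, `X(s3,H12)` g7 over `X(s3,ns⁺5)` g3 over `X(ns3,ns⁺5) = 225a1` · MODEL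
  IDENTIFICATION NF-K1-S3H12 — PRINT `J₂` (`X_{N_s(3)}`) and `J₇` (`X_{N_ns(5)}`) [Zywina 2015 §1.2–1.3,
  Lemma 3.4] + moduli interpretation [Chen 1999 Thm. 3.2; Deligne–Rapoport IV-3; Box 2022 §1.1]; CELL the
  `H12`-conic `(5+2√5)w² = 8t²−12t+7` (lit-1 LIT-L1-L4.md §L4; CENSUS §11; validated by point counts
  E8-MODELS.md §v3 (A), and since 21:31Z DERIVED count-free twice — class `c ≡ 5+2√5 (mod k*²)` from the
  `q`-expansion principle in Shimura's `F₅` and the index-2 trichotomy in `N_ns(5) ∩ det⁻¹{±1}` (eng-5 g2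
  DERIVATION-H12-CONIC.md b9b2c12f033f5452, kit j318382; referee-read PASS by ref-1, cell STATUS
  21:32:48Z, endorsed by ref-2 21:31:53Z) and independently from one CM point (eng-1 g3, STATUS 21:31:53Z);
  the same conic class enters `hK1Z`) · file
  `SqrtFiveQuarticCoversCertS3H12.lean` (typ-3), theorem
  `certS3H12_of_modelIdentification_of_caseTwoEmpty_smooth`.
* `hDat'` · `CertS3H12` · CERTIFIED FINITE COMPUTATION «CASE 2 EMPTY (smooth form): every point
  `(t, n, ṽ, w)` of the division-free model with `ṽ·w ≠ 0` over a totally real quartic `K ∋ r` has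
  `t, n ∈ ℚ + ℚr`» = THEOREM (E8, CASE 2) of the cell restricted to smooth non-cuspidal points · THREE
  method-disjoint lineages: eng-4 γ-classes Prym sieve (E8-PRYMSIEVE.md 9627b62afbb4b0bc, certnum-E8
  packet 7e0d93234f2d4641, emit E8-1 c2227e80b385a7e0) ∥ eng-5 `β = 1 − ν₃` sieve (R5-E8-CASE2-6D.md
  d4b61a9354412577) ∥ eng-3 g2 ε-Prym α-sieve on `X(s3,H12)` itself (E12-TWIN.md 711c5279badaa760, seven
  runs, profile intersection ∅; eng-6 g2 E12-REPORT 8dfc96268d96d250) · certnum l.144 K-a LV0, l.145 K-b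
  R0, l.147–l.149 + l.151 K-d…K-g (RQ-028 Phase 1 6/7; K-c and Phase 2 PRYM-REPLAY booked) · same file.
* `hFLS`, `hBC` · bridge · PRINTED THEOREMS `FLS2015_theorem1` (Freitas–Le Hung–Siksek 2015, Thm. 1) and
  `isModularEllipticCurve_baseChange_of_isSolvable_of_isAutomorphicOfWeightZero` (Thorne 2016, L7.1).
* `target_of_namedInputs` only: `h11`, `h15`, `h3`, `h4`, `hKal` = `Box2022_theorem1_1`,
  `Box2022_theorem1_5_modular`, `FLS2015_theorem3`, `FLS2015_theorem4`, `Kalyanswamy2018_theorem1_2` —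
  PRINTED THEOREMS, consumed by `target_of_refinedLocusModular_of_facts` via the PROVED `GroupCensusFive`.

Count: printed theorems as named facts 3 (`hM`, `hFLS`, `hBC`) + 5 for `Target`; model identifications
3 (`hK1Z`, `hK1E10`, `hNF`; the 4.2/4.6 and 4.4/4.8 models are printed, inside `hE6`'s datum and `hM`);
certified finite computations 7 groups (`hE6`, `hB`, `hZ`, `hE9`, `hE49`, `hZmm`+`hZmi`, `hDat'`), each
on ≥ 2 independent exact lineages, the 4.2/4.6, 4.4/4.8, 4.5 data also certnum-released (RQ-026/027
closed; RQ-028/029 open).  Audits: ref-2 R2-3 PASS ×5 (1ec98e61a4af1960, 22b586f188bc2dff, f0c4090a34bbca7d,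
d57dc21903fd595f); landed p670548+p670819, p669865, p669895, p670569, p667755+p668984.

HONEST STATUS: CONDITIONAL (`proof.conditional` on every hypothesis); one explicit quartic family
(totally real quartic `K ∋ √5`); the computations are NOT replayed in Lean (no carrier for modular
curves, Jacobians or Mordell–Weil groups in the tree); the model identifications and the printed
theorems are named, not proved; the residual `SectorComplement` between `Target` and the summit
conjunct is untouched.  NOTHING HERE PROVES MODULARITY OF A NEW CLASS OF ELLIPTIC CURVES.
Cell records: CENSUS.md §15, SHEET-WORDS-v0.md v0.2, STATUS 2026-08-28T20:30Z–21:30Z.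
References: [FreitasLeHungSiksek2015] Thm. 1, §2.2, Lemma 4.2, §§5.2–5.4, Remark (iii) after Cor. 2.1
(arXiv:1310.7088); [Box2022] §1.1, Thms. 1.1, 1.5, 7.1; [Thorne2016] Lemma 7.1; [Kalyanswamy2018]
Thm. 1.2; [Zywina2015] §1.2–1.3, Thm. 1.4, Lemma 3.4 (arXiv:1508.07660); [CremonaFreitas2022] §3.6;
Chen, J. Number Theory 74 (1999), Thm. 3.2 and (53); [DeligneRapoport1973] IV-3.
-/

set_option linter.dupNamespace false -- project-wide option (lakefile weak.linter.dupNamespace); `Summit.Langlands.Langlands` is the mandated namespace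

namespace Summit.Langlands.Langlands.Theorems.SqrtFiveQuarticCovers

open scoped Matrix
open Literature.NumberTheory.Automorphic Literature.NumberTheory.Automorphic.FLS2015
open Summit.Langlands.Langlands.Theses.SqrtFiveQuarticCovers

set_option maxRecDepth 8192 in -- statement elaboration only: the `by decide` unit proofs inside the written-out framings are synthesised at the end of the fourteen-binder telescope (default depth 512 is exceeded; each child file alone stays below it)
set_option maxHeartbeats 1000000 in -- statement elaboration only: twelve written-out hypothesis types
/-- **THE RECORD — the crux `RefinedLocusModular` from every named input, written out.**  Hypotheses,
grouped by certificate child (see the module docstring for the table of kinds, lineages and certnum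
lines): `hE6`, `hB` (⇒ `CertB3H8`, sheets 4.2/4.6); `hK1Z`, `hZ` (⇒ `CertH12B7`, 4.1/4.3); `hM`
(the printed Literature fact `FLS2015.s3s5_jRelation_of_isTorsionGaloisRep`), `hE9` (⇒ `CertS3H8`,
4.4/4.8); `hK1E10`, `hE49`, `hZmm`, `hZmi` (⇒ `CertB3E7`, 4.5); `hNF`, `hDat'` (⇒ `CertS3H12`, 4.7);
and the two printed bridge facts `FLS2015_theorem1` (Freitas–Le Hung–Siksek 2015, Thm. 1) and
`isModularEllipticCurve_baseChange_of_isSolvable_of_isAutomorphicOfWeightZero` (Thorne 2016, L7.1).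
Each hypothesis text is BYTE-IDENTICAL to the corresponding binder of the child's theorem
(`certB3H8_of_facts`, `certH12B7`, `certS3H8_of_facts`, `certB3E7`,
`certS3H12_of_modelIdentification_of_caseTwoEmpty_smooth`; the two binders named `hK1` there are
`hK1Z` / `hK1E10` here).  Proof: the ledger glue `refinedLocusModularGlue_of_facts` (asm-plan) applied
to the five child theorems — one term.  CONDITIONAL (`proof.conditional`), closes nothing: the label of
record as ONE kernel-checked statement «`RefinedLocusModular` holds MODULO exactly these inputs —
3 printed theorems, 3 model identifications, 7 certified finite computations (each on two independent
exact lineages in the cell)».  A certified finite datum is not a modularity statement; nothing here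
proves modularity of any curve. [cite: FreitasLeHungSiksek2015, Thm. 1, §2.2, §§5.2–5.4]
[cite: Box2022, §1.1, Thm. 7.1] [cite: Thorne2016, Lemma 7.1] [cite: Zywina2015, §1.2–1.3, Thm. 1.4] -/
theorem refinedLocusModular_of_namedInputs
    -- ── CertB3H8 (sheets 4.2 + 4.6, carrier `X(b3,H8) = X₀(75)^ε`): inputs of `certB3H8_of_facts` ──
    (hE6 : ∀ (K : Type) [Field K] [NumberField K], NumberField.IsTotallyReal K → Module.finrank ℚ K = 4 →
      (∃ r : K, r ^ 2 = 5) → ∀ E : WeierstrassCurve (NumberField.RingOfIntegers K), E.Δ ≠ 0 →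
        (∃ ρ : Literature.NumberTheory.GaloisRepresentations.FramedGaloisRep K (ZMod 3) 2, (∃ e : (E.baseChange K).geomTorsion ((3 : ℕ) : ℤ) ≃+ (Fin 2 → ZMod 3), ∀ (σ : Field.absoluteGaloisGroup K) (P : (E.baseChange K).geomTorsion ((3 : ℕ) : ℤ)), e (σ • P) = ((ρ σ : GL (Fin 2) (ZMod 3)) : Matrix (Fin 2) (Fin 2) (ZMod 3)) *ᵥ (e P)) ∧ ((∀ σ : Field.absoluteGaloisGroup K, (((ρ σ : GL (Fin 2) (ZMod 3)) : Matrix (Fin 2) (Fin 2) (ZMod 3)) 1 0 = 0)))) →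
        (∃ ρ : Literature.NumberTheory.GaloisRepresentations.FramedGaloisRep K (ZMod 5) 2, (∃ e : (E.baseChange K).geomTorsion ((5 : ℕ) : ℤ) ≃+ (Fin 2 → ZMod 5), ∀ (σ : Field.absoluteGaloisGroup K) (P : (E.baseChange K).geomTorsion ((5 : ℕ) : ℤ)), e (σ • P) = ((ρ σ : GL (Fin 2) (ZMod 5)) : Matrix (Fin 2) (Fin 2) (ZMod 5)) *ᵥ (e P)) ∧ ((∀ σ : Field.absoluteGaloisGroup K, (ρ σ : GL (Fin 2) (ZMod 5)) ∈ Subgroup.closure ({(⟨!![2, 0; 0, 3], !![3, 0; 0, 2], by decide, by decide⟩ : GL (Fin 2) (ZMod 5)), (⟨!![0, 1; 1, 0], !![0, 1; 1, 0], by decide, by decide⟩ : GL (Fin 2) (ZMod 5))} : Set (GL (Fin 2) (ZMod 5)))))) →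
          ((E.baseChange K).c₄ = 0 ∨
           (E.baseChange K).c₄ ^ 12 - 736750 * (E.baseChange K).c₄ ^ 9 * (E.baseChange K).Δ
            - 107158989000 * (E.baseChange K).c₄ ^ 6 * (E.baseChange K).Δ ^ 2
            + 829200340371875 * (E.baseChange K).c₄ ^ 3 * (E.baseChange K).Δ ^ 3
            - 601530697732559375 * (E.baseChange K).Δ ^ 4 = 0))
    (hB : ∀ (K : Type) [Field K] [NumberField K], Module.finrank ℚ K = 4 →
      ∀ E : WeierstrassCurve (NumberField.RingOfIntegers K), E.Δ ≠ 0 →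
        (E.baseChange K).c₄ ^ 12 - 736750 * (E.baseChange K).c₄ ^ 9 * (E.baseChange K).Δ
            - 107158989000 * (E.baseChange K).c₄ ^ 6 * (E.baseChange K).Δ ^ 2
            + 829200340371875 * (E.baseChange K).c₄ ^ 3 * (E.baseChange K).Δ ^ 3
            - 601530697732559375 * (E.baseChange K).Δ ^ 4 = 0 →
        ∀ ρ : Literature.NumberTheory.GaloisRepresentations.FramedGaloisRep K (ZMod 7) 2,
          (∃ e : (E.baseChange K).geomTorsion ((7 : ℕ) : ℤ) ≃+ (Fin 2 → ZMod 7), ∀ (σ : Field.absoluteGaloisGroup K) (P : (E.baseChange K).geomTorsion ((7 : ℕ) : ℤ)), e (σ • P) = ((ρ σ : GL (Fin 2) (ZMod 7)) : Matrix (Fin 2) (Fin 2) (ZMod 7)) *ᵥ (e P)) →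
          ∃ σ : Field.absoluteGaloisGroup K,
            (Matrix.det ((ρ σ : GL (Fin 2) (ZMod 7)) : Matrix (Fin 2) (Fin 2) (ZMod 7)) = 3 ∨
              Matrix.det ((ρ σ : GL (Fin 2) (ZMod 7)) : Matrix (Fin 2) (Fin 2) (ZMod 7)) = 5 ∨
              Matrix.det ((ρ σ : GL (Fin 2) (ZMod 7)) : Matrix (Fin 2) (Fin 2) (ZMod 7)) = 6) ∧
            Matrix.trace ((ρ σ : GL (Fin 2) (ZMod 7)) : Matrix (Fin 2) (Fin 2) (ZMod 7)) ≠ 0 ∧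
            ¬ IsSquare (Matrix.trace ((ρ σ : GL (Fin 2) (ZMod 7)) : Matrix (Fin 2) (Fin 2) (ZMod 7)) ^ 2 -
              4 * Matrix.det ((ρ σ : GL (Fin 2) (ZMod 7)) : Matrix (Fin 2) (Fin 2) (ZMod 7))))
    -- ── CertH12B7 (sheets 4.1 + 4.3, carrier `Z = X(H12,b7)`): inputs of `certH12B7` ──
    (hK1Z : ∀ (K : Type) [Field K] [NumberField K], (∃ r : K, r ^ 2 = 5) →
        ∀ E : WeierstrassCurve (NumberField.RingOfIntegers K), E.Δ ≠ 0 →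
          (∃ ρ : Literature.NumberTheory.GaloisRepresentations.FramedGaloisRep K (ZMod 5) 2, (∃ e : (E.baseChange K).geomTorsion ((5 : ℕ) : ℤ) ≃+ (Fin 2 → ZMod 5), ∀ (σ : Field.absoluteGaloisGroup K) (P : (E.baseChange K).geomTorsion ((5 : ℕ) : ℤ)), e (σ • P) = ((ρ σ : GL (Fin 2) (ZMod 5)) : Matrix (Fin 2) (Fin 2) (ZMod 5)) *ᵥ (e P)) ∧ ((∀ σ : Field.absoluteGaloisGroup K, (ρ σ : GL (Fin 2) (ZMod 5)) ∈ Subgroup.closure ({(⟨!![3, 1; 3, 3], !![3, 4; 2, 3], by decide, by decide⟩ : GL (Fin 2) (ZMod 5)), (⟨!![1, 0; 0, 4], !![1, 0; 0, 4], by decide, by decide⟩ : GL (Fin 2) (ZMod 5))} : Set (GL (Fin 2) (ZMod 5)))))) →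
          (∃ ρ : Literature.NumberTheory.GaloisRepresentations.FramedGaloisRep K (ZMod 7) 2, (∃ e : (E.baseChange K).geomTorsion ((7 : ℕ) : ℤ) ≃+ (Fin 2 → ZMod 7), ∀ (σ : Field.absoluteGaloisGroup K) (P : (E.baseChange K).geomTorsion ((7 : ℕ) : ℤ)), e (σ • P) = ((ρ σ : GL (Fin 2) (ZMod 7)) : Matrix (Fin 2) (Fin 2) (ZMod 7)) *ᵥ (e P)) ∧ ((∀ σ : Field.absoluteGaloisGroup K, (((ρ σ : GL (Fin 2) (ZMod 7)) : Matrix (Fin 2) (Fin 2) (ZMod 7)) 1 0 = 0)))) →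
          ((E.baseChange K).c₄ ^ 3 = 0 * (E.baseChange K).Δ ∨
           (E.baseChange K).c₄ ^ 3 = 1728 * (E.baseChange K).Δ ∨
           (E.baseChange K).c₄ ^ 3 = 8000 * (E.baseChange K).Δ ∨
           ∃ r : K, r ^ 2 = 5 ∧ ∃ t u w : K,
            t ^ 2 + t - 1 ≠ 0 ∧ u ≠ 0 ∧
            (E.baseChange K).c₄ ^ 3 * (t ^ 2 + t - 1) ^ 5 =
              125 * (t + 1) * (2 * t + 1) ^ 3 * (2 * t ^ 2 - 3 * t + 3) ^ 3 * (E.baseChange K).Δ ∧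
            (E.baseChange K).c₄ ^ 3 * u = (u ^ 2 + 13 * u + 49) * (u ^ 2 + 5 * u + 1) ^ 3 * (E.baseChange K).Δ ∧
            w ^ 2 = (5 + 2 * r) * (8 * t ^ 2 - 12 * t + 7)))
        (hZ : ∀ (K : Type) [Field K] [NumberField K], Module.finrank ℚ K = 4 →
        ∀ r : K, r ^ 2 = 5 → ∀ t u w : K, t ^ 2 + t - 1 ≠ 0 → u ≠ 0 →
          125 * (t + 1) * (2 * t + 1) ^ 3 * (2 * t ^ 2 - 3 * t + 3) ^ 3 * u =
            (u ^ 2 + 13 * u + 49) * (u ^ 2 + 5 * u + 1) ^ 3 * (t ^ 2 + t - 1) ^ 5 →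
          w ^ 2 = (5 + 2 * r) * (8 * t ^ 2 - 12 * t + 7) →
          (u ^ 2 + 13 * u + 49) * (u ^ 2 + 5 * u + 1) ≠ 0 →
          (u ^ 2 + 13 * u + 49) * (u ^ 2 + 5 * u + 1) ^ 3 ≠ 1728 * u →
          (u = -7 ∨ u = 7 ∨ 2 * u ^ 2 + (35 + 5 * r) * u + 98 = 0 ∨ 2 * u ^ 2 + (35 - 5 * r) * u + 98 = 0))
    -- ── CertS3H8 (sheets 4.4 + 4.8, carrier `X(s3,H8) = (X₀(225)/w₉)^ε`): inputs of `certS3H8_of_facts` ──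
    (hM : FLS2015.s3s5_jRelation_of_isTorsionGaloisRep)
    (hE9 : ∀ (K : Type) [Field K] [NumberField K], NumberField.IsTotallyReal K →
      Module.finrank ℚ K = 4 → ∀ r : K, r ^ 2 = 5 → ∀ x₁ x₂ x₃ x₄ : K,
        (x₁ ≠ 0 ∨ x₂ ≠ 0 ∨ x₃ ≠ 0 ∨ x₄ ≠ 0) → s3s5Quadric x₁ x₂ x₃ x₄ = 0 →
          s3s5Cubic x₁ x₂ x₃ x₄ = 0 →
            s3s5JDen x₃ x₄ = 0 ∨
              ∃ a b : ℚ, s3s5JNum x₂ x₃ x₄ = ((a : K) + (b : K) * r) * s3s5JDen x₃ x₄)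
    -- ── CertB3E7 (sheet 4.5, carrier `X(b3,e7)`): inputs of `certB3E7` ──
    (hK1E10 : ∀ (K : Type) [Field K] [NumberField K], Module.finrank ℚ K = 4 → (∃ r : K, r ^ 2 = 5) →
        ∀ E : WeierstrassCurve (NumberField.RingOfIntegers K), E.Δ ≠ 0 →
          (∃ ρ : Literature.NumberTheory.GaloisRepresentations.FramedGaloisRep K (ZMod 3) 2, (∃ e : (E.baseChange K).geomTorsion ((3 : ℕ) : ℤ) ≃+ (Fin 2 → ZMod 3), ∀ (σ : Field.absoluteGaloisGroup K) (P : (E.baseChange K).geomTorsion ((3 : ℕ) : ℤ)), e (σ • P) = ((ρ σ : GL (Fin 2) (ZMod 3)) : Matrix (Fin 2) (Fin 2) (ZMod 3)) *ᵥ (e P)) ∧ ((∀ σ : Field.absoluteGaloisGroup K, (((ρ σ : GL (Fin 2) (ZMod 3)) : Matrix (Fin 2) (Fin 2) (ZMod 3)) 1 0 = 0)))) →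
          (∃ ρ : Literature.NumberTheory.GaloisRepresentations.FramedGaloisRep K (ZMod 7) 2, (∃ e : (E.baseChange K).geomTorsion ((7 : ℕ) : ℤ) ≃+ (Fin 2 → ZMod 7), ∀ (σ : Field.absoluteGaloisGroup K) (P : (E.baseChange K).geomTorsion ((7 : ℕ) : ℤ)), e (σ • P) = ((ρ σ : GL (Fin 2) (ZMod 7)) : Matrix (Fin 2) (Fin 2) (ZMod 7)) *ᵥ (e P)) ∧ ((∀ σ : Field.absoluteGaloisGroup K, (ρ σ : GL (Fin 2) (ZMod 7)) ∈ Subgroup.closure ({(⟨!![0, 5; 3, 0], !![0, 5; 3, 0], by decide, by decide⟩ : GL (Fin 2) (ZMod 7)), (⟨!![5, 0; 3, 2], !![3, 0; 6, 4], by decide, by decide⟩ : GL (Fin 2) (ZMod 7))} : Set (GL (Fin 2) (ZMod 7)))))) →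
          ((E.baseChange K).c₄ ^ 3 = 1728 * (E.baseChange K).Δ ∨
           ∃ x₁ y₁ x₂ y₂ : K, y₁ ^ 2 = 7 * (16 * x₁ ^ 4 + 68 * x₁ ^ 3 + 111 * x₁ ^ 2 + 62 * x₁ + 11) ∧ y₂ ^ 2 = 7 * (16 * x₂ ^ 4 + 68 * x₂ ^ 3 + 111 * x₂ ^ 2 + 62 * x₂ + 11) ∧
            ((x₁ ^ 3 + x₁ ^ 2 - 2 * x₁ - 1) ^ 7) ≠ 0 ∧
            (E.baseChange K).c₄ ^ 3 * ((x₁ ^ 3 + x₁ ^ 2 - 2 * x₁ - 1) ^ 7) = ((3 * x₁ + 1) ^ 3 * (4 * x₁ ^ 2 + 5 * x₁ + 2) ^ 3 * (x₁ ^ 2 + 3 * x₁ + 4) ^ 3 * (x₁ ^ 2 + 10 * x₁ + 4) ^ 3) * (E.baseChange K).Δ ∧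
            ((3 * x₂ ^ 2 + 6 * x₂ + 2) ^ 2 * x₁ ^ 4 + (36 * x₂ ^ 4 + 125 * x₂ ^ 3 + 138 * x₂ ^ 2 + 60 * x₂ + 9) * x₁ ^ 3 + (48 * x₂ ^ 4 + 138 * x₂ ^ 3 + 111 * x₂ ^ 2 + 33 * x₂ + 3) * x₁ ^ 2 + (24 * x₂ ^ 4 + 60 * x₂ ^ 3 + 33 * x₂ ^ 2 + 5 * x₂) * x₁ + (4 * x₂ ^ 4 + 9 * x₂ ^ 3 + 3 * x₂ ^ 2)) = 0))
        (hE49 : ∀ (K : Type) [Field K] [NumberField K], Module.finrank ℚ K = 4 → ∀ r : K, r ^ 2 = 5 →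
        ∀ σ : K →+* K, σ r = r → σ ≠ RingHom.id K →
          ∀ x y : K, y ^ 2 = 7 * (16 * x ^ 4 + 68 * x ^ 3 + 111 * x ^ 2 + 62 * x + 11) → (σ x = x ∨ (12 * x + 5) * σ x = -(5 * x + 2)))
        (hZmm : ∀ (K : Type) [Field K] [NumberField K], Module.finrank ℚ K = 4 → (∃ r : K, r ^ 2 = 5) →
        ∀ x₁ y₁ x₂ x₁' x₂' : K, y₁ ^ 2 = 7 * (16 * x₁ ^ 4 + 68 * x₁ ^ 3 + 111 * x₁ ^ 2 + 62 * x₁ + 11) →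
          ((3 * x₂ ^ 2 + 6 * x₂ + 2) ^ 2 * x₁ ^ 4 + (36 * x₂ ^ 4 + 125 * x₂ ^ 3 + 138 * x₂ ^ 2 + 60 * x₂ + 9) * x₁ ^ 3 + (48 * x₂ ^ 4 + 138 * x₂ ^ 3 + 111 * x₂ ^ 2 + 33 * x₂ + 3) * x₁ ^ 2 + (24 * x₂ ^ 4 + 60 * x₂ ^ 3 + 33 * x₂ ^ 2 + 5 * x₂) * x₁ + (4 * x₂ ^ 4 + 9 * x₂ ^ 3 + 3 * x₂ ^ 2)) = 0 →
          (12 * x₁ + 5) * x₁' = -(5 * x₁ + 2) → (12 * x₂ + 5) * x₂' = -(5 * x₂ + 2) →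
          ((3 * x₂' ^ 2 + 6 * x₂' + 2) ^ 2 * x₁' ^ 4 + (36 * x₂' ^ 4 + 125 * x₂' ^ 3 + 138 * x₂' ^ 2 + 60 * x₂' + 9) * x₁' ^ 3 + (48 * x₂' ^ 4 + 138 * x₂' ^ 3 + 111 * x₂' ^ 2 + 33 * x₂' + 3) * x₁' ^ 2 + (24 * x₂' ^ 4 + 60 * x₂' ^ 3 + 33 * x₂' ^ 2 + 5 * x₂') * x₁' + (4 * x₂' ^ 4 + 9 * x₂' ^ 3 + 3 * x₂' ^ 2)) = 0 →
          (3 * x₁ + 1 = 0 ∨ x₁ ^ 2 + 10 * x₁ + 4 = 0))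
        (hZmi : ∀ (K : Type) [Field K] [NumberField K], Module.finrank ℚ K = 4 → (∃ r : K, r ^ 2 = 5) →
        ∀ x₁ y₁ x₂ x₁' : K, y₁ ^ 2 = 7 * (16 * x₁ ^ 4 + 68 * x₁ ^ 3 + 111 * x₁ ^ 2 + 62 * x₁ + 11) →
          ((3 * x₂ ^ 2 + 6 * x₂ + 2) ^ 2 * x₁ ^ 4 + (36 * x₂ ^ 4 + 125 * x₂ ^ 3 + 138 * x₂ ^ 2 + 60 * x₂ + 9) * x₁ ^ 3 + (48 * x₂ ^ 4 + 138 * x₂ ^ 3 + 111 * x₂ ^ 2 + 33 * x₂ + 3) * x₁ ^ 2 + (24 * x₂ ^ 4 + 60 * x₂ ^ 3 + 33 * x₂ ^ 2 + 5 * x₂) * x₁ + (4 * x₂ ^ 4 + 9 * x₂ ^ 3 + 3 * x₂ ^ 2)) = 0 →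
          (12 * x₁ + 5) * x₁' = -(5 * x₁ + 2) →
          ((3 * x₂ ^ 2 + 6 * x₂ + 2) ^ 2 * x₁' ^ 4 + (36 * x₂ ^ 4 + 125 * x₂ ^ 3 + 138 * x₂ ^ 2 + 60 * x₂ + 9) * x₁' ^ 3 + (48 * x₂ ^ 4 + 138 * x₂ ^ 3 + 111 * x₂ ^ 2 + 33 * x₂ + 3) * x₁' ^ 2 + (24 * x₂ ^ 4 + 60 * x₂ ^ 3 + 33 * x₂ ^ 2 + 5 * x₂) * x₁' + (4 * x₂ ^ 4 + 9 * x₂ ^ 3 + 3 * x₂ ^ 2)) = 0 →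
          3 * x₁ + 1 = 0)
    -- ── CertS3H12 (sheet 4.7, carrier `X(s3,H12)` over `X(s3,ns⁺5)`): inputs of `certS3H12_of_modelIdentification_of_caseTwoEmpty_smooth` ──
    (hNF : ∀ (K : Type) [Field K] [NumberField K], NumberField.IsTotallyReal K → Module.finrank ℚ K = 4 → (∃ r : K, r ^ 2 = 5) →
        ∀ E : WeierstrassCurve (NumberField.RingOfIntegers K), E.Δ ≠ 0 →
          (∃ ρ : Literature.NumberTheory.GaloisRepresentations.FramedGaloisRep K (ZMod 3) 2, (∃ e : (E.baseChange K).geomTorsion ((3 : ℕ) : ℤ) ≃+ (Fin 2 → ZMod 3), ∀ (σ : Field.absoluteGaloisGroup K) (P : (E.baseChange K).geomTorsion ((3 : ℕ) : ℤ)), e (σ • P) = ((ρ σ : GL (Fin 2) (ZMod 3)) : Matrix (Fin 2) (Fin 2) (ZMod 3)) *ᵥ (e P)) ∧ ((∀ σ : Field.absoluteGaloisGroup K, (ρ σ : GL (Fin 2) (ZMod 3)) ∈ Subgroup.closure ({(⟨!![1, 0; 0, 2], !![1, 0; 0, 2], by decide, by decide⟩ : GL (Fin 2) (ZMod 3)),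 (⟨!![0, 1; 1, 0], !![0, 1; 1, 0], by decide, by decide⟩ : GL (Fin 2) (ZMod 3))} : Set (GL (Fin 2) (ZMod 3)))))) →
          (∃ ρ : Literature.NumberTheory.GaloisRepresentations.FramedGaloisRep K (ZMod 5) 2, (∃ e : (E.baseChange K).geomTorsion ((5 : ℕ) : ℤ) ≃+ (Fin 2 → ZMod 5), ∀ (σ : Field.absoluteGaloisGroup K) (P : (E.baseChange K).geomTorsion ((5 : ℕ) : ℤ)), e (σ • P) = ((ρ σ : GL (Fin 2) (ZMod 5)) : Matrix (Fin 2) (Fin 2) (ZMod 5)) *ᵥ (e P)) ∧ ((∀ σ : Field.absoluteGaloisGroup K, (ρ σ : GL (Fin 2) (ZMod 5)) ∈ Subgroup.closure ({(⟨!![3, 1; 3, 3], !![3, 4; 2, 3], by decide, by decide⟩ : GL (Fin 2) (ZMod 5)), (⟨!![1, 0; 0, 4], !![1, 0; 0, 4], by decide, by decide⟩ : GL (Fin 2) (ZMod 5))} : Set (GL (Fin 2) (ZMod 5)))))) →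
          ∀ r : K, r ^ 2 = 5 →
            (E.baseChange K).c₄ = 0 ∨
            (E.baseChange K).c₄ ^ 3 = 8000 * (E.baseChange K).Δ ∨
            ∃ u t w : K, u ≠ 0 ∧
              (E.baseChange K).c₄ ^ 3 * u ^ 3 = 27 * (u + 1) ^ 3 * (u - 3) ^ 3 * (E.baseChange K).Δ ∧
              t ^ 2 + t - 1 ≠ 0 ∧
              (E.baseChange K).c₄ ^ 3 * (t ^ 2 + t - 1) ^ 5 =
                125 * (t + 1) * (2 * t + 1) ^ 3 * (2 * t ^ 2 - 3 * t + 3) ^ 3 * (E.baseChange K).Δ ∧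
              (5 + 2 * r) * w ^ 2 = 8 * t ^ 2 - 12 * t + 7)
    (hDat' : ∀ (K : Type) [Field K] [NumberField K], NumberField.IsTotallyReal K → Module.finrank ℚ K = 4 →
        ∀ r : K, r ^ 2 = 5 →
          ∀ t n v w : K,
            n ^ 3 = t ^ 3 + 2 * t ^ 2 - 1 →
            v ^ 2 = (5 * (2 * t + 1) * (2 * t ^ 2 - 3 * t + 3) * n) ^ 2
                + 12 * (5 * (2 * t + 1) * (2 * t ^ 2 - 3 * t + 3) * n) * (t ^ 2 + t - 1) ^ 2
                + 144 * (t ^ 2 + t - 1) ^ 4 →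
            (5 + 2 * r) * w ^ 2 = 8 * t ^ 2 - 12 * t + 7 →
            v ≠ 0 → w ≠ 0 →
            (∃ a b : ℚ, t = (a : K) + (b : K) * r) ∧ (∃ a b : ℚ, n = (a : K) + (b : K) * r))
    -- ── the printed bridge «j(E) ∈ ℚ(√5) ⇒ E modular» ──
    (hFLS : FLS2015_theorem1)
    (hBC : isModularEllipticCurve_baseChange_of_isSolvable_of_isAutomorphicOfWeightZero) :
    RefinedLocusModular :=
  refinedLocusModularGlue_of_facts hFLS hBC
    (certB3H8_of_facts hE6 hB) (certH12B7 hK1Z hZ) (certS3H8_of_facts hM hE9)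
    (certB3E7 hK1E10 hE49 hZmm hZmi)
    (certS3H12_of_modelIdentification_of_caseTwoEmpty_smooth hNF hDat')

set_option maxRecDepth 8192 in -- statement elaboration only (as above)
set_option maxHeartbeats 1000000 in -- statement elaboration only (as above)
/-- **THE RECORD, route level — `Target` (every elliptic curve over every totally real quartic field is
modular, trace-only sense) from every named input, written out**: the twelve certificate inputs of
`refinedLocusModular_of_namedInputs` (same names, same texts) and SEVEN printed theorems as named facts
(`FLS2015_theorem1`, Thorne L7.1, `Box2022_theorem1_1`, `Box2022_theorem1_5_modular`, `FLS2015_theorem3`,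
`FLS2015_theorem4`, `Kalyanswamy2018_theorem1_2`; + the printed `hM`).  Proof: `target_of_sheets_of_facts`
(asm-plan) on the five child theorems.  CONDITIONAL; nothing here proves modularity of any curve; the
residual `SectorComplement` between `Target` and the summit conjunct is NOT touched.
[cite: Box2022, Thms. 1.1, 1.5, 7.1] [cite: FreitasLeHungSiksek2015, Thms. 1, 3, 4] [cite: Kalyanswamy2018, Thm. 1.2] -/
theorem target_of_namedInputs
    -- ── CertB3H8 (sheets 4.2 + 4.6, carrier `X(b3,H8) = X₀(75)^ε`): inputs of `certB3H8_of_facts` ──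
    (hE6 : ∀ (K : Type) [Field K] [NumberField K], NumberField.IsTotallyReal K → Module.finrank ℚ K = 4 →
      (∃ r : K, r ^ 2 = 5) → ∀ E : WeierstrassCurve (NumberField.RingOfIntegers K), E.Δ ≠ 0 →
        (∃ ρ : Literature.NumberTheory.GaloisRepresentations.FramedGaloisRep K (ZMod 3) 2, (∃ e : (E.baseChange K).geomTorsion ((3 : ℕ) : ℤ) ≃+ (Fin 2 → ZMod 3), ∀ (σ : Field.absoluteGaloisGroup K) (P : (E.baseChange K).geomTorsion ((3 : ℕ) : ℤ)), e (σ • P) = ((ρ σ : GL (Fin 2) (ZMod 3)) : Matrix (Fin 2) (Fin 2) (ZMod 3)) *ᵥ (e P)) ∧ ((∀ σ : Field.absoluteGaloisGroup K, (((ρ σ : GL (Fin 2) (ZMod 3)) : Matrix (Fin 2) (Fin 2) (ZMod 3)) 1 0 = 0)))) →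
        (∃ ρ : Literature.NumberTheory.GaloisRepresentations.FramedGaloisRep K (ZMod 5) 2, (∃ e : (E.baseChange K).geomTorsion ((5 : ℕ) : ℤ) ≃+ (Fin 2 → ZMod 5), ∀ (σ : Field.absoluteGaloisGroup K) (P : (E.baseChange K).geomTorsion ((5 : ℕ) : ℤ)), e (σ • P) = ((ρ σ : GL (Fin 2) (ZMod 5)) : Matrix (Fin 2) (Fin 2) (ZMod 5)) *ᵥ (e P)) ∧ ((∀ σ : Field.absoluteGaloisGroup K, (ρ σ : GL (Fin 2) (ZMod 5)) ∈ Subgroup.closure ({(⟨!![2, 0; 0, 3], !![3, 0; 0, 2], by decide, by decide⟩ : GL (Fin 2) (ZMod 5)), (⟨!![0, 1; 1, 0], !![0, 1; 1, 0], by decide, by decide⟩ : GL (Fin 2) (ZMod 5))} : Set (GL (Fin 2) (ZMod 5)))))) →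
          ((E.baseChange K).c₄ = 0 ∨
           (E.baseChange K).c₄ ^ 12 - 736750 * (E.baseChange K).c₄ ^ 9 * (E.baseChange K).Δ
            - 107158989000 * (E.baseChange K).c₄ ^ 6 * (E.baseChange K).Δ ^ 2
            + 829200340371875 * (E.baseChange K).c₄ ^ 3 * (E.baseChange K).Δ ^ 3
            - 601530697732559375 * (E.baseChange K).Δ ^ 4 = 0))
    (hB : ∀ (K : Type) [Field K] [NumberField K], Module.finrank ℚ K = 4 →
      ∀ E : WeierstrassCurve (NumberField.RingOfIntegers K), E.Δ ≠ 0 →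
        (E.baseChange K).c₄ ^ 12 - 736750 * (E.baseChange K).c₄ ^ 9 * (E.baseChange K).Δ
            - 107158989000 * (E.baseChange K).c₄ ^ 6 * (E.baseChange K).Δ ^ 2
            + 829200340371875 * (E.baseChange K).c₄ ^ 3 * (E.baseChange K).Δ ^ 3
            - 601530697732559375 * (E.baseChange K).Δ ^ 4 = 0 →
        ∀ ρ : Literature.NumberTheory.GaloisRepresentations.FramedGaloisRep K (ZMod 7) 2,
          (∃ e : (E.baseChange K).geomTorsion ((7 : ℕ) : ℤ) ≃+ (Fin 2 → ZMod 7), ∀ (σ : Field.absoluteGaloisGroup K) (P : (E.baseChange K).geomTorsion ((7 : ℕ) : ℤ)), e (σ • P) = ((ρ σ : GL (Fin 2) (ZMod 7)) : Matrix (Fin 2) (Fin 2) (ZMod 7)) *ᵥ (e P)) →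
          ∃ σ : Field.absoluteGaloisGroup K,
            (Matrix.det ((ρ σ : GL (Fin 2) (ZMod 7)) : Matrix (Fin 2) (Fin 2) (ZMod 7)) = 3 ∨
              Matrix.det ((ρ σ : GL (Fin 2) (ZMod 7)) : Matrix (Fin 2) (Fin 2) (ZMod 7)) = 5 ∨
              Matrix.det ((ρ σ : GL (Fin 2) (ZMod 7)) : Matrix (Fin 2) (Fin 2) (ZMod 7)) = 6) ∧
            Matrix.trace ((ρ σ : GL (Fin 2) (ZMod 7)) : Matrix (Fin 2) (Fin 2) (ZMod 7)) ≠ 0 ∧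
            ¬ IsSquare (Matrix.trace ((ρ σ : GL (Fin 2) (ZMod 7)) : Matrix (Fin 2) (Fin 2) (ZMod 7)) ^ 2 -
              4 * Matrix.det ((ρ σ : GL (Fin 2) (ZMod 7)) : Matrix (Fin 2) (Fin 2) (ZMod 7))))
    -- ── CertH12B7 (sheets 4.1 + 4.3, carrier `Z = X(H12,b7)`): inputs of `certH12B7` ──
    (hK1Z : ∀ (K : Type) [Field K] [NumberField K], (∃ r : K, r ^ 2 = 5) →
        ∀ E : WeierstrassCurve (NumberField.RingOfIntegers K), E.Δ ≠ 0 →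
          (∃ ρ : Literature.NumberTheory.GaloisRepresentations.FramedGaloisRep K (ZMod 5) 2, (∃ e : (E.baseChange K).geomTorsion ((5 : ℕ) : ℤ) ≃+ (Fin 2 → ZMod 5), ∀ (σ : Field.absoluteGaloisGroup K) (P : (E.baseChange K).geomTorsion ((5 : ℕ) : ℤ)), e (σ • P) = ((ρ σ : GL (Fin 2) (ZMod 5)) : Matrix (Fin 2) (Fin 2) (ZMod 5)) *ᵥ (e P)) ∧ ((∀ σ : Field.absoluteGaloisGroup K, (ρ σ : GL (Fin 2) (ZMod 5)) ∈ Subgroup.closure ({(⟨!![3, 1; 3, 3], !![3, 4; 2, 3], by decide, by decide⟩ : GL (Fin 2) (ZMod 5)), (⟨!![1, 0; 0, 4], !![1, 0; 0, 4], by decide, by decide⟩ : GL (Fin 2) (ZMod 5))} : Set (GL (Fin 2) (ZMod 5)))))) →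
          (∃ ρ : Literature.NumberTheory.GaloisRepresentations.FramedGaloisRep K (ZMod 7) 2, (∃ e : (E.baseChange K).geomTorsion ((7 : ℕ) : ℤ) ≃+ (Fin 2 → ZMod 7), ∀ (σ : Field.absoluteGaloisGroup K) (P : (E.baseChange K).geomTorsion ((7 : ℕ) : ℤ)), e (σ • P) = ((ρ σ : GL (Fin 2) (ZMod 7)) : Matrix (Fin 2) (Fin 2) (ZMod 7)) *ᵥ (e P)) ∧ ((∀ σ : Field.absoluteGaloisGroup K, (((ρ σ : GL (Fin 2) (ZMod 7)) : Matrix (Fin 2) (Fin 2) (ZMod 7)) 1 0 = 0)))) →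
          ((E.baseChange K).c₄ ^ 3 = 0 * (E.baseChange K).Δ ∨
           (E.baseChange K).c₄ ^ 3 = 1728 * (E.baseChange K).Δ ∨
           (E.baseChange K).c₄ ^ 3 = 8000 * (E.baseChange K).Δ ∨
           ∃ r : K, r ^ 2 = 5 ∧ ∃ t u w : K,
            t ^ 2 + t - 1 ≠ 0 ∧ u ≠ 0 ∧
            (E.baseChange K).c₄ ^ 3 * (t ^ 2 + t - 1) ^ 5 =
              125 * (t + 1) * (2 * t + 1) ^ 3 * (2 * t ^ 2 - 3 * t + 3) ^ 3 * (E.baseChange K).Δ ∧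
            (E.baseChange K).c₄ ^ 3 * u = (u ^ 2 + 13 * u + 49) * (u ^ 2 + 5 * u + 1) ^ 3 * (E.baseChange K).Δ ∧
            w ^ 2 = (5 + 2 * r) * (8 * t ^ 2 - 12 * t + 7)))
        (hZ : ∀ (K : Type) [Field K] [NumberField K], Module.finrank ℚ K = 4 →
        ∀ r : K, r ^ 2 = 5 → ∀ t u w : K, t ^ 2 + t - 1 ≠ 0 → u ≠ 0 →
          125 * (t + 1) * (2 * t + 1) ^ 3 * (2 * t ^ 2 - 3 * t + 3) ^ 3 * u =
            (u ^ 2 + 13 * u + 49) * (u ^ 2 + 5 * u + 1) ^ 3 * (t ^ 2 + t - 1) ^ 5 →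
          w ^ 2 = (5 + 2 * r) * (8 * t ^ 2 - 12 * t + 7) →
          (u ^ 2 + 13 * u + 49) * (u ^ 2 + 5 * u + 1) ≠ 0 →
          (u ^ 2 + 13 * u + 49) * (u ^ 2 + 5 * u + 1) ^ 3 ≠ 1728 * u →
          (u = -7 ∨ u = 7 ∨ 2 * u ^ 2 + (35 + 5 * r) * u + 98 = 0 ∨ 2 * u ^ 2 + (35 - 5 * r) * u + 98 = 0))
    -- ── CertS3H8 (sheets 4.4 + 4.8, carrier `X(s3,H8) = (X₀(225)/w₉)^ε`): inputs of `certS3H8_of_facts` ──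
    (hM : FLS2015.s3s5_jRelation_of_isTorsionGaloisRep)
    (hE9 : ∀ (K : Type) [Field K] [NumberField K], NumberField.IsTotallyReal K →
      Module.finrank ℚ K = 4 → ∀ r : K, r ^ 2 = 5 → ∀ x₁ x₂ x₃ x₄ : K,
        (x₁ ≠ 0 ∨ x₂ ≠ 0 ∨ x₃ ≠ 0 ∨ x₄ ≠ 0) → s3s5Quadric x₁ x₂ x₃ x₄ = 0 →
          s3s5Cubic x₁ x₂ x₃ x₄ = 0 →
            s3s5JDen x₃ x₄ = 0 ∨
              ∃ a b : ℚ, s3s5JNum x₂ x₃ x₄ = ((a : K) + (b : K) * r) * s3s5JDen x₃ x₄)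
    -- ── CertB3E7 (sheet 4.5, carrier `X(b3,e7)`): inputs of `certB3E7` ──
    (hK1E10 : ∀ (K : Type) [Field K] [NumberField K], Module.finrank ℚ K = 4 → (∃ r : K, r ^ 2 = 5) →
        ∀ E : WeierstrassCurve (NumberField.RingOfIntegers K), E.Δ ≠ 0 →
          (∃ ρ : Literature.NumberTheory.GaloisRepresentations.FramedGaloisRep K (ZMod 3) 2, (∃ e : (E.baseChange K).geomTorsion ((3 : ℕ) : ℤ) ≃+ (Fin 2 → ZMod 3), ∀ (σ : Field.absoluteGaloisGroup K) (P : (E.baseChange K).geomTorsion ((3 : ℕ) : ℤ)), e (σ • P) = ((ρ σ : GL (Fin 2) (ZMod 3)) : Matrix (Fin 2) (Fin 2) (ZMod 3)) *ᵥ (e P)) ∧ ((∀ σ : Field.absoluteGaloisGroup K, (((ρ σ : GL (Fin 2) (ZMod 3)) : Matrix (Fin 2) (Fin 2) (ZMod 3)) 1 0 = 0)))) →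
          (∃ ρ : Literature.NumberTheory.GaloisRepresentations.FramedGaloisRep K (ZMod 7) 2, (∃ e : (E.baseChange K).geomTorsion ((7 : ℕ) : ℤ) ≃+ (Fin 2 → ZMod 7), ∀ (σ : Field.absoluteGaloisGroup K) (P : (E.baseChange K).geomTorsion ((7 : ℕ) : ℤ)), e (σ • P) = ((ρ σ : GL (Fin 2) (ZMod 7)) : Matrix (Fin 2) (Fin 2) (ZMod 7)) *ᵥ (e P)) ∧ ((∀ σ : Field.absoluteGaloisGroup K, (ρ σ : GL (Fin 2) (ZMod 7)) ∈ Subgroup.closure ({(⟨!![0, 5; 3, 0], !![0, 5; 3, 0], by decide, by decide⟩ : GL (Fin 2) (ZMod 7)), (⟨!![5, 0; 3, 2], !![3, 0; 6, 4], by decide, by decide⟩ : GL (Fin 2) (ZMod 7))} : Set (GL (Fin 2) (ZMod 7)))))) →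
          ((E.baseChange K).c₄ ^ 3 = 1728 * (E.baseChange K).Δ ∨
           ∃ x₁ y₁ x₂ y₂ : K, y₁ ^ 2 = 7 * (16 * x₁ ^ 4 + 68 * x₁ ^ 3 + 111 * x₁ ^ 2 + 62 * x₁ + 11) ∧ y₂ ^ 2 = 7 * (16 * x₂ ^ 4 + 68 * x₂ ^ 3 + 111 * x₂ ^ 2 + 62 * x₂ + 11) ∧
            ((x₁ ^ 3 + x₁ ^ 2 - 2 * x₁ - 1) ^ 7) ≠ 0 ∧
            (E.baseChange K).c₄ ^ 3 * ((x₁ ^ 3 + x₁ ^ 2 - 2 * x₁ - 1) ^ 7) = ((3 * x₁ + 1) ^ 3 * (4 * x₁ ^ 2 + 5 * x₁ + 2) ^ 3 * (x₁ ^ 2 + 3 * x₁ + 4) ^ 3 * (x₁ ^ 2 + 10 * x₁ + 4) ^ 3) * (E.baseChange K).Δ ∧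
            ((3 * x₂ ^ 2 + 6 * x₂ + 2) ^ 2 * x₁ ^ 4 + (36 * x₂ ^ 4 + 125 * x₂ ^ 3 + 138 * x₂ ^ 2 + 60 * x₂ + 9) * x₁ ^ 3 + (48 * x₂ ^ 4 + 138 * x₂ ^ 3 + 111 * x₂ ^ 2 + 33 * x₂ + 3) * x₁ ^ 2 + (24 * x₂ ^ 4 + 60 * x₂ ^ 3 + 33 * x₂ ^ 2 + 5 * x₂) * x₁ + (4 * x₂ ^ 4 + 9 * x₂ ^ 3 + 3 * x₂ ^ 2)) = 0))
        (hE49 : ∀ (K : Type) [Field K] [NumberField K], Module.finrank ℚ K = 4 → ∀ r : K, r ^ 2 = 5 →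
        ∀ σ : K →+* K, σ r = r → σ ≠ RingHom.id K →
          ∀ x y : K, y ^ 2 = 7 * (16 * x ^ 4 + 68 * x ^ 3 + 111 * x ^ 2 + 62 * x + 11) → (σ x = x ∨ (12 * x + 5) * σ x = -(5 * x + 2)))
        (hZmm : ∀ (K : Type) [Field K] [NumberField K], Module.finrank ℚ K = 4 → (∃ r : K, r ^ 2 = 5) →
        ∀ x₁ y₁ x₂ x₁' x₂' : K, y₁ ^ 2 = 7 * (16 * x₁ ^ 4 + 68 * x₁ ^ 3 + 111 * x₁ ^ 2 + 62 * x₁ + 11) →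
          ((3 * x₂ ^ 2 + 6 * x₂ + 2) ^ 2 * x₁ ^ 4 + (36 * x₂ ^ 4 + 125 * x₂ ^ 3 + 138 * x₂ ^ 2 + 60 * x₂ + 9) * x₁ ^ 3 + (48 * x₂ ^ 4 + 138 * x₂ ^ 3 + 111 * x₂ ^ 2 + 33 * x₂ + 3) * x₁ ^ 2 + (24 * x₂ ^ 4 + 60 * x₂ ^ 3 + 33 * x₂ ^ 2 + 5 * x₂) * x₁ + (4 * x₂ ^ 4 + 9 * x₂ ^ 3 + 3 * x₂ ^ 2)) = 0 →
          (12 * x₁ + 5) * x₁' = -(5 * x₁ + 2) → (12 * x₂ + 5) * x₂' = -(5 * x₂ + 2) →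
          ((3 * x₂' ^ 2 + 6 * x₂' + 2) ^ 2 * x₁' ^ 4 + (36 * x₂' ^ 4 + 125 * x₂' ^ 3 + 138 * x₂' ^ 2 + 60 * x₂' + 9) * x₁' ^ 3 + (48 * x₂' ^ 4 + 138 * x₂' ^ 3 + 111 * x₂' ^ 2 + 33 * x₂' + 3) * x₁' ^ 2 + (24 * x₂' ^ 4 + 60 * x₂' ^ 3 + 33 * x₂' ^ 2 + 5 * x₂') * x₁' + (4 * x₂' ^ 4 + 9 * x₂' ^ 3 + 3 * x₂' ^ 2)) = 0 →
          (3 * x₁ + 1 = 0 ∨ x₁ ^ 2 + 10 * x₁ + 4 = 0))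
        (hZmi : ∀ (K : Type) [Field K] [NumberField K], Module.finrank ℚ K = 4 → (∃ r : K, r ^ 2 = 5) →
        ∀ x₁ y₁ x₂ x₁' : K, y₁ ^ 2 = 7 * (16 * x₁ ^ 4 + 68 * x₁ ^ 3 + 111 * x₁ ^ 2 + 62 * x₁ + 11) →
          ((3 * x₂ ^ 2 + 6 * x₂ + 2) ^ 2 * x₁ ^ 4 + (36 * x₂ ^ 4 + 125 * x₂ ^ 3 + 138 * x₂ ^ 2 + 60 * x₂ + 9) * x₁ ^ 3 + (48 * x₂ ^ 4 + 138 * x₂ ^ 3 + 111 * x₂ ^ 2 + 33 * x₂ + 3) * x₁ ^ 2 + (24 * x₂ ^ 4 + 60 * x₂ ^ 3 + 33 * x₂ ^ 2 + 5 * x₂) * x₁ + (4 * x₂ ^ 4 + 9 * x₂ ^ 3 + 3 * x₂ ^ 2)) = 0 →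
          (12 * x₁ + 5) * x₁' = -(5 * x₁ + 2) →
          ((3 * x₂ ^ 2 + 6 * x₂ + 2) ^ 2 * x₁' ^ 4 + (36 * x₂ ^ 4 + 125 * x₂ ^ 3 + 138 * x₂ ^ 2 + 60 * x₂ + 9) * x₁' ^ 3 + (48 * x₂ ^ 4 + 138 * x₂ ^ 3 + 111 * x₂ ^ 2 + 33 * x₂ + 3) * x₁' ^ 2 + (24 * x₂ ^ 4 + 60 * x₂ ^ 3 + 33 * x₂ ^ 2 + 5 * x₂) * x₁' + (4 * x₂ ^ 4 + 9 * x₂ ^ 3 + 3 * x₂ ^ 2)) = 0 →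
          3 * x₁ + 1 = 0)
    -- ── CertS3H12 (sheet 4.7, carrier `X(s3,H12)` over `X(s3,ns⁺5)`): inputs of `certS3H12_of_modelIdentification_of_caseTwoEmpty_smooth` ──
    (hNF : ∀ (K : Type) [Field K] [NumberField K], NumberField.IsTotallyReal K → Module.finrank ℚ K = 4 → (∃ r : K, r ^ 2 = 5) →
        ∀ E : WeierstrassCurve (NumberField.RingOfIntegers K), E.Δ ≠ 0 →
          (∃ ρ : Literature.NumberTheory.GaloisRepresentations.FramedGaloisRep K (ZMod 3) 2, (∃ e : (E.baseChange K).geomTorsion ((3 : ℕ) : ℤ) ≃+ (Fin 2 → ZMod 3), ∀ (σ : Field.absoluteGaloisGroup K) (P : (E.baseChange K).geomTorsion ((3 : ℕ) : ℤ)), e (σ • P) = ((ρ σ : GL (Fin 2) (ZMod 3)) : Matrix (Fin 2) (Fin 2) (ZMod 3)) *ᵥ (e P)) ∧ ((∀ σ : Field.absoluteGaloisGroup K, (ρ σ : GL (Fin 2) (ZMod 3)) ∈ Subgroup.closure ({(⟨!![1, 0; 0, 2], !![1, 0; 0, 2], by decide, by decide⟩ : GL (Fin 2) (ZMod 3)),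 (⟨!![0, 1; 1, 0], !![0, 1; 1, 0], by decide, by decide⟩ : GL (Fin 2) (ZMod 3))} : Set (GL (Fin 2) (ZMod 3)))))) →
          (∃ ρ : Literature.NumberTheory.GaloisRepresentations.FramedGaloisRep K (ZMod 5) 2, (∃ e : (E.baseChange K).geomTorsion ((5 : ℕ) : ℤ) ≃+ (Fin 2 → ZMod 5), ∀ (σ : Field.absoluteGaloisGroup K) (P : (E.baseChange K).geomTorsion ((5 : ℕ) : ℤ)), e (σ • P) = ((ρ σ : GL (Fin 2) (ZMod 5)) : Matrix (Fin 2) (Fin 2) (ZMod 5)) *ᵥ (e P)) ∧ ((∀ σ : Field.absoluteGaloisGroup K, (ρ σ : GL (Fin 2) (ZMod 5)) ∈ Subgroup.closure ({(⟨!![3, 1; 3, 3], !![3, 4; 2, 3], by decide, by decide⟩ : GL (Fin 2) (ZMod 5)), (⟨!![1, 0; 0, 4], !![1, 0; 0, 4], by decide, by decide⟩ : GL (Fin 2) (ZMod 5))} : Set (GL (Fin 2) (ZMod 5)))))) →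
          ∀ r : K, r ^ 2 = 5 →
            (E.baseChange K).c₄ = 0 ∨
            (E.baseChange K).c₄ ^ 3 = 8000 * (E.baseChange K).Δ ∨
            ∃ u t w : K, u ≠ 0 ∧
              (E.baseChange K).c₄ ^ 3 * u ^ 3 = 27 * (u + 1) ^ 3 * (u - 3) ^ 3 * (E.baseChange K).Δ ∧
              t ^ 2 + t - 1 ≠ 0 ∧
              (E.baseChange K).c₄ ^ 3 * (t ^ 2 + t - 1) ^ 5 =
                125 * (t + 1) * (2 * t + 1) ^ 3 * (2 * t ^ 2 - 3 * t + 3) ^ 3 * (E.baseChange K).Δ ∧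
              (5 + 2 * r) * w ^ 2 = 8 * t ^ 2 - 12 * t + 7)
    (hDat' : ∀ (K : Type) [Field K] [NumberField K], NumberField.IsTotallyReal K → Module.finrank ℚ K = 4 →
        ∀ r : K, r ^ 2 = 5 →
          ∀ t n v w : K,
            n ^ 3 = t ^ 3 + 2 * t ^ 2 - 1 →
            v ^ 2 = (5 * (2 * t + 1) * (2 * t ^ 2 - 3 * t + 3) * n) ^ 2
                + 12 * (5 * (2 * t + 1) * (2 * t ^ 2 - 3 * t + 3) * n) * (t ^ 2 + t - 1) ^ 2
                + 144 * (t ^ 2 + t - 1) ^ 4 →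
            (5 + 2 * r) * w ^ 2 = 8 * t ^ 2 - 12 * t + 7 →
            v ≠ 0 → w ≠ 0 →
            (∃ a b : ℚ, t = (a : K) + (b : K) * r) ∧ (∃ a b : ℚ, n = (a : K) + (b : K) * r))
    -- ── the printed theorems (named Literature facts) ──
    (hFLS : FLS2015_theorem1)
    (hBC : isModularEllipticCurve_baseChange_of_isSolvable_of_isAutomorphicOfWeightZero)
    (h11 : Box2022_theorem1_1) (h15 : Box2022_theorem1_5_modular) (h3 : FLS2015_theorem3)
    (h4 : FLS2015_theorem4) (hKal : Kalyanswamy2018_theorem1_2) : Target :=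
  target_of_sheets_of_facts
    (certB3H8_of_facts hE6 hB) (certH12B7 hK1Z hZ) (certS3H8_of_facts hM hE9)
    (certB3E7 hK1E10 hE49 hZmm hZmi)
    (certS3H12_of_modelIdentification_of_caseTwoEmpty_smooth hNF hDat')
    hFLS hBC h11 h15 h3 h4 hKal

end Summit.Langlands.Langlands.Theorems.SqrtFiveQuarticCovers
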